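import Summits.SmoothPoincare4.SmoothPoincare4.Theorems.CylinderEntropyImmortalAreaToFloorCutPiecePointwise
import HarnessLib

/-!
# Route `CylinderEntropy`, item `ImmortalAreaToFloor` (stmt-SmoothPoincare4-17197):
# the stacking contradiction — two height-cut full sheets on one vertical give Gaussian density
# close to `2` at the midpoint (module Γ4/Γ6 of `BLUEPRINT-17197-c2.md`, the real-analysis core)

For a closed immersed `f : M⁴ → ℝ⁶` with area measure `μ_g`, Gaussian weights
`G_s(x) = exp(-‖f - x‖²/(4s))/(4πs)²`, two centres `x₁, x₂` within `g/2` of a third centre `p`,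
complementary continuous height weights `u + v = 1` (`u, v ≥ 0`), scales `0 < σ₀`, `0 < σ₁`,
`η > 0` and a gap parameter `0 < δ₀ ≤ 1`, the theorems `midpoint_density_ge` (analysis) and
`stacking_arith` (bookkeeping) derive `False` from:
* the two CUT-PIECE inequalities (conclusions of the landed `cutPiece_twoScale` at `x₁` with `u` and
  at `x₂` with `v`, abstract error constant `K⋆ ≥ 0`),
* the unit INITIAL densities `e^{-4σ₀} - (K_H/4)σ₀ ≤ ∫ G_{σ₀}(x_i)` (landed `initialDensity_ge`),
* the Gaussian mass bounds `∫ G_{2σ₀}(x_i) ≤ C`,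
* the UPPER density bound at the midpoint `∫ G_{(1+η)σ₁}(p) ≤ 2 - δ₀` (entropy `< 2`),
* four numeric smallness conditions on the parameters.
The only analysis left here is the midpoint comparison
`∫ G_{(1+η)σ₁}(p) ≥ m (∫ u G_{σ₁}(x₁) + ∫ v G_{σ₁}(x₂))`,
`m = (1+η)⁻² exp(-(1+η⁻¹)(g/2)²/(4(1+η)σ₁))` (landed `gaussian_midpoint_comparison`, `u + v = 1`);
the rest is bookkeeping of real inequalities.

References: W. K. Allard, Ann. of Math. 95 (1972) §6 (the stacking step of the integrality
theorem); L. Simon, *Lectures on GMT* (1983) §17.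
-/

-- the prescribed namespace `Summit.SmoothPoincare4.SmoothPoincare4.…` repeats `SmoothPoincare4`
set_option linter.dupNamespace false

noncomputable section

open Bundle Set Function Filter MeasureTheory Module
open scoped Manifold ContDiff Topology RealInnerProductSpace BigOperators

namespace Summit.SmoothPoincare4.SmoothPoincare4.Cruxes.CylinderRungTwo.KillingFlux

open Literature.Geometry.Riemannian Literature.Geometry.Riemannian.EuclideanHypersurface
open Literature.Geometry.Lorentzian Literature.Geometry.Lorentzian.PseudoRiemannianMetric
open Summit.SmoothPoincare4.SmoothPoincare4.Theorems.GaussianBounds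

variable {M : Type*} [TopologicalSpace M] [ChartedSpace (EuclideanSpace ℝ (Fin 4)) M]
  [IsManifold (𝓡 4) ∞ M] [CompactSpace M] [T2Space M] [MeasurableSpace M] [BorelSpace M]

/-- **Midpoint comparison of Gaussian densities with complementary weights.**  For continuous
weights `u, v ≥ 0` with `u + v = 1`, centres `x₁, x₂` within `g/2` of `p`, `σ₁ > 0`, `η > 0`:
`m (∫ u(z₅) G_{σ₁}(x₁) + ∫ v(z₅) G_{σ₁}(x₂)) ≤ ∫ G_{(1+η)σ₁}(p)`,
`m = (1+η)⁻² exp(-(1+η⁻¹)(g/2)²/(4(1+η)σ₁))` (pointwise `gaussian_midpoint_comparison`).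
[cite: Allard1972, §6] -/
theorem midpoint_density_ge {f : M → EuclideanSpace ℝ (Fin 6)}
    (hf : (euclideanMetric (EuclideanSpace ℝ (Fin 6))).IsSpacelikeImmersion (𝓡 4) f)
    {u v : ℝ → ℝ} (hu : Continuous u) (hv : Continuous v) (hu0 : ∀ t, 0 ≤ u t) (hv0 : ∀ t, 0 ≤ v t)
    (huv : ∀ t, u t + v t = 1) (x₁ x₂ p : EuclideanSpace ℝ (Fin 6)) {g σ₁ η : ℝ} (hσ₁ : 0 < σ₁)
    (hη : 0 < η) (hx₁ : ‖x₁ - p‖ ≤ g / 2) (hx₂ : ‖x₂ - p‖ ≤ g / 2) :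
    (1 + η)⁻¹ ^ 2 * Real.exp (-((1 + η⁻¹) * (g / 2) ^ 2) / (4 * ((1 + η) * σ₁))) *
        (∫ w, u (f w 5) * (Real.exp (-‖f w - x₁‖ ^ 2 / (4 * σ₁)) / (4 * Real.pi * σ₁) ^ 2)
            ∂riemannianMeasure ((euclideanMetric (EuclideanSpace ℝ (Fin 6))).inducedRiemannianMetric f
              contMDiff_pullbackBilin_holds hf)
          + ∫ w, v (f w 5) * (Real.exp (-‖f w - x₂‖ ^ 2 / (4 * σ₁)) / (4 * Real.pi * σ₁) ^ 2)
            ∂riemannianMeasure ((euclideanMetric (EuclideanSpace ℝ (Fin 6))).inducedRiemannianMetric f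
              contMDiff_pullbackBilin_holds hf)) ≤
      ∫ w, Real.exp (-‖f w - p‖ ^ 2 / (4 * ((1 + η) * σ₁))) / (4 * Real.pi * ((1 + η) * σ₁)) ^ 2
        ∂riemannianMeasure ((euclideanMetric (EuclideanSpace ℝ (Fin 6))).inducedRiemannianMetric f
          contMDiff_pullbackBilin_holds hf) := by
  set g₁ := (euclideanMetric (EuclideanSpace ℝ (Fin 6))).inducedRiemannianMetric f
    contMDiff_pullbackBilin_holds hf with hg₁
  set μ := riemannianMeasure g₁ with hμ
  set τ : ℝ := (1 + η) * σ₁ with hτ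
  have hη1 : 0 < 1 + η := by linarith
  have hτ0 : 0 < τ := mul_pos hη1 hσ₁
  have hτσ : τ / (1 + η) = σ₁ := by rw [hτ]; field_simp
  set m : ℝ := (1 + η)⁻¹ ^ 2 * Real.exp (-((1 + η⁻¹) * (g / 2) ^ 2) / (4 * τ)) with hm
  have hm0 : 0 ≤ m := by positivity
  set G1 : M → ℝ := fun w => Real.exp (-‖f w - x₁‖ ^ 2 / (4 * σ₁)) / (4 * Real.pi * σ₁) ^ 2 with hG1
  set G2 : M → ℝ := fun w => Real.exp (-‖f w - x₂‖ ^ 2 / (4 * σ₁)) / (4 * Real.pi * σ₁) ^ 2 with hG2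
  set Gp : M → ℝ := fun w => Real.exp (-‖f w - p‖ ^ 2 / (4 * τ)) / (4 * Real.pi * τ) ^ 2 with hGp
  have hfc : Continuous f := hf.contMDiff_self.continuous
  have h5c : Continuous fun w => f w 5 :=
    (EuclideanSpace.proj (5 : Fin 6) : EuclideanSpace ℝ (Fin 6) →L[ℝ] ℝ).continuous.comp hfc
  have hG1c : Continuous G1 := continuous_gaussianWeight_comp hf x₁ σ₁
  have hG2c : Continuous G2 := continuous_gaussianWeight_comp hf x₂ σ₁
  have hGpc : Continuous Gp := continuous_gaussianWeight_comp hf p τ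
  -- pointwise comparison at each centre
  have hpt : ∀ (x : EuclideanSpace ℝ (Fin 6)), ‖x - p‖ ≤ g / 2 → ∀ w,
      m * (Real.exp (-‖f w - x‖ ^ 2 / (4 * σ₁)) / (4 * Real.pi * σ₁) ^ 2) ≤ Gp w := by
    intro x hx w
    have hcmp := gaussian_midpoint_comparison (f w) x p hτ0 hη
    rw [hτσ] at hcmp
    refine le_trans ?_ hcmp
    refine mul_le_mul_of_nonneg_right ?_ (gaussianWeight_comp_nonneg f x w)
    refine mul_le_mul_of_nonneg_left (Real.exp_le_exp.2 ?_) (by positivity)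
    rw [neg_div, neg_div, neg_le_neg_iff]
    refine div_le_div_of_nonneg_right ?_ (by positivity)
    refine mul_le_mul_of_nonneg_left ?_ (by positivity)
    exact pow_le_pow_left₀ (norm_nonneg _) hx 2
  -- integrate with the weights
  have hi1 : Integrable (fun w => u (f w 5) * G1 w) μ :=
    integrable_of_continuous (h := g₁) ((hu.comp h5c).mul hG1c)
  have hi2 : Integrable (fun w => v (f w 5) * G2 w) μ :=
    integrable_of_continuous (h := g₁) ((hv.comp h5c).mul hG2c)
  have hip : Integrable Gp μ := integrable_of_continuous (h := g₁) hGpc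
  have hle : ∀ w, m * (u (f w 5) * G1 w) + m * (v (f w 5) * G2 w) ≤ Gp w := by
    intro w
    have h1 := mul_le_mul_of_nonneg_left (hpt x₁ hx₁ w) (hu0 (f w 5))
    have h2 := mul_le_mul_of_nonneg_left (hpt x₂ hx₂ w) (hv0 (f w 5))
    have hsum : u (f w 5) * Gp w + v (f w 5) * Gp w = Gp w := by
      rw [← add_mul, huv, one_mul]
    calc m * (u (f w 5) * G1 w) + m * (v (f w 5) * G2 w)
        = u (f w 5) * (m * G1 w) + v (f w 5) * (m * G2 w) := by ring
      _ ≤ u (f w 5) * Gp w + v (f w 5) * Gp w := add_le_add h1 h2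
      _ = Gp w := hsum
  have hint : ∫ w, (m * (u (f w 5) * G1 w) + m * (v (f w 5) * G2 w)) ∂μ ≤ ∫ w, Gp w ∂μ :=
    integral_mono ((hi1.const_mul m).add (hi2.const_mul m)) hip hle
  rw [integral_add (hi1.const_mul m) (hi2.const_mul m), integral_const_mul, integral_const_mul]
    at hint
  simpa only [mul_add] using hint

/-- **The stacking contradiction (bookkeeping of the real inequalities).**  With
`Φᵢ = ∫ G_{σ₀}(xᵢ)`, `Ψᵢ = ∫ G_{2σ₀}(xᵢ)`, `U₁ = ∫ u G_{σ₁}(x₁)`, `V₂ = ∫ v G_{σ₁}(x₂)`,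
`P = ∫ G_{(1+η)σ₁}(p)`, `t = e^{-g²/(72σ₀)}`: the two cut-piece inequalities (`cutPiece_twoScale`),
the unit initial densities (`initialDensity_ge`), the mass bounds `Ψᵢ ≤ C`, the midpoint comparison
`m (U₁ + V₂) ≤ P` (`midpoint_density_ge`), the upper density bound `P ≤ 2 - δ₀` and the numeric
smallness conditions `1 - δ₀/8 ≤ m`, `1 - δ₀/16 ≤ e^{-4σ₁}`,
`e^{4σ₀}(K_H/4)σ₀ + 4 e^{4σ₀} t C ≤ δ₀/16`, `K⋆ σ₁ ≤ δ₀/16` are contradictory: they force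
`P ≥ 2(1 - δ₀/8)((1 - δ₀/16)² - δ₀/16) > 2 - δ₀`. [cite: Allard1972, §6] -/
theorem stacking_arith {Φ₁ Φ₂ Ψ₁ Ψ₂ U₁ V₂ P C KH Kst σ₀ σ₁ δ₀ m t : ℝ}
    (hσ₀ : 0 ≤ σ₀) (hδ₀ : 0 < δ₀) (hδ₁ : δ₀ ≤ 1) (hKst : 0 ≤ Kst) (ht : 0 ≤ t)
    (hcut₁ : Real.exp (4 * σ₀) * (Φ₁ - 4 * t * Ψ₁) ≤
      Real.exp (4 * σ₁) * U₁ + Real.exp (4 * σ₁) * Kst * (σ₁ - σ₀))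
    (hcut₂ : Real.exp (4 * σ₀) * (Φ₂ - 4 * t * Ψ₂) ≤
      Real.exp (4 * σ₁) * V₂ + Real.exp (4 * σ₁) * Kst * (σ₁ - σ₀))
    (hinit₁ : Real.exp (-(4 * σ₀)) - KH / 4 * σ₀ ≤ Φ₁)
    (hinit₂ : Real.exp (-(4 * σ₀)) - KH / 4 * σ₀ ≤ Φ₂)
    (hC₁ : Ψ₁ ≤ C) (hC₂ : Ψ₂ ≤ C) (hmid : m * (U₁ + V₂) ≤ P) (hup : P ≤ 2 - δ₀)
    (hm : 1 - δ₀ / 8 ≤ m) (hE : 1 - δ₀ / 16 ≤ Real.exp (-(4 * σ₁)))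
    (ha : Real.exp (4 * σ₀) * (KH / 4) * σ₀ + 4 * Real.exp (4 * σ₀) * t * C ≤ δ₀ / 16)
    (hK : Kst * σ₁ ≤ δ₀ / 16) : False := by
  have hE0pos : 0 < Real.exp (4 * σ₀) := Real.exp_pos _
  have hE1pos : 0 < Real.exp (4 * σ₁) := Real.exp_pos _
  have hE0inv : Real.exp (4 * σ₀) * Real.exp (-(4 * σ₀)) = 1 := by
    rw [← Real.exp_add, add_neg_cancel, Real.exp_zero]
  have hE1inv : Real.exp (4 * σ₁) * Real.exp (-(4 * σ₁)) = 1 := by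
    rw [← Real.exp_add, add_neg_cancel, Real.exp_zero]
  -- products with the positive factors `e^{4σ₀}`, `e^{4σ₁}`, `e^{-4σ₁}`
  have h1 : Real.exp (4 * σ₀) * (Real.exp (-(4 * σ₀)) - KH / 4 * σ₀) ≤ Real.exp (4 * σ₀) * Φ₁ :=
    mul_le_mul_of_nonneg_left hinit₁ hE0pos.le
  have h2 : Real.exp (4 * σ₀) * (Real.exp (-(4 * σ₀)) - KH / 4 * σ₀) ≤ Real.exp (4 * σ₀) * Φ₂ :=
    mul_le_mul_of_nonneg_left hinit₂ hE0pos.le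
  have h3 : Real.exp (4 * σ₀) * (t * Ψ₁) ≤ Real.exp (4 * σ₀) * (t * C) :=
    mul_le_mul_of_nonneg_left (mul_le_mul_of_nonneg_left hC₁ ht) hE0pos.le
  have h4 : Real.exp (4 * σ₀) * (t * Ψ₂) ≤ Real.exp (4 * σ₀) * (t * C) :=
    mul_le_mul_of_nonneg_left (mul_le_mul_of_nonneg_left hC₂ ht) hE0pos.le
  have h5 : 0 ≤ Real.exp (4 * σ₁) * Kst * σ₀ := by positivity
  -- `e^{4σ₁} U₁ ≥ 1 - δ₀/16 - δ₀/16 · e^{4σ₁}` and the same for `V₂`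
  have h6 : Real.exp (4 * σ₁) * (Kst * σ₁) ≤ Real.exp (4 * σ₁) * (δ₀ / 16) :=
    mul_le_mul_of_nonneg_left hK hE1pos.le
  have hU : 1 - δ₀ / 16 - Real.exp (4 * σ₁) * (δ₀ / 16) ≤ Real.exp (4 * σ₁) * U₁ := by
    linarith [hcut₁, h1, h3, h5, h6, hE0inv, ha]
  have hV : 1 - δ₀ / 16 - Real.exp (4 * σ₁) * (δ₀ / 16) ≤ Real.exp (4 * σ₁) * V₂ := by
    linarith [hcut₂, h2, h4, h5, h6, hE0inv, ha]
  -- multiply by `e^{-4σ₁} ≥ 1 - δ₀/16`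
  have hEneg : 0 < Real.exp (-(4 * σ₁)) := Real.exp_pos _
  have hU' : Real.exp (-(4 * σ₁)) * (1 - δ₀ / 16) - δ₀ / 16 ≤ U₁ := by
    have := mul_le_mul_of_nonneg_left hU hEneg.le
    have e1 : Real.exp (-(4 * σ₁)) * (Real.exp (4 * σ₁) * U₁) = U₁ := by
      rw [← mul_assoc, mul_comm (Real.exp _), hE1inv, one_mul]
    have e2 : Real.exp (-(4 * σ₁)) * (Real.exp (4 * σ₁) * (δ₀ / 16)) = δ₀ / 16 := by
      rw [← mul_assoc, mul_comm (Real.exp _), hE1inv, one_mul]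
    rw [mul_sub, e1, e2] at this
    exact this
  have hV' : Real.exp (-(4 * σ₁)) * (1 - δ₀ / 16) - δ₀ / 16 ≤ V₂ := by
    have := mul_le_mul_of_nonneg_left hV hEneg.le
    have e1 : Real.exp (-(4 * σ₁)) * (Real.exp (4 * σ₁) * V₂) = V₂ := by
      rw [← mul_assoc, mul_comm (Real.exp _), hE1inv, one_mul]
    have e2 : Real.exp (-(4 * σ₁)) * (Real.exp (4 * σ₁) * (δ₀ / 16)) = δ₀ / 16 := by
      rw [← mul_assoc, mul_comm (Real.exp _), hE1inv, one_mul]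
    rw [mul_sub, e1, e2] at this
    exact this
  have hδ16 : 0 ≤ 1 - δ₀ / 16 := by linarith
  have h7 : (1 - δ₀ / 16) * (1 - δ₀ / 16) ≤ Real.exp (-(4 * σ₁)) * (1 - δ₀ / 16) :=
    mul_le_mul_of_nonneg_right hE hδ16
  have hsum : 2 * ((1 - δ₀ / 16) * (1 - δ₀ / 16) - δ₀ / 16) ≤ U₁ + V₂ := by linarith
  have hbr : 0 ≤ 2 * ((1 - δ₀ / 16) * (1 - δ₀ / 16) - δ₀ / 16) := by nlinarith
  have hm0 : 0 ≤ m := by linarith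
  have hP : (1 - δ₀ / 8) * (2 * ((1 - δ₀ / 16) * (1 - δ₀ / 16) - δ₀ / 16)) ≤ P :=
    le_trans (le_trans (mul_le_mul_of_nonneg_right hm hbr) (mul_le_mul_of_nonneg_left hsum hm0)) hmid
  have hnum : 2 - δ₀ < (1 - δ₀ / 8) * (2 * ((1 - δ₀ / 16) * (1 - δ₀ / 16) - δ₀ / 16)) := by
    nlinarith [mul_pos hδ₀ hδ₀, mul_pos (mul_pos hδ₀ hδ₀) hδ₀]
  linarith

end Summit.SmoothPoincare4.SmoothPoincare4.Cruxes.CylinderRungTwo.KillingFlux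

end
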